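import Mathlib.Analysis.Complex.ExponentialBounds
import Mathlib.Analysis.Real.Pi.Bounds
import Mathlib.Analysis.SpecialFunctions.Log.Deriv
import Mathlib.Analysis.Calculus.Deriv.MeanValue
import Literature.NumberTheory.LFunctions.RiemannSiegelFacts
import Literature.Analysis.SpecialFunctions.DigammaGauss
import HarnessLib

/-!
# First-order Stirling bounds for the Riemann–Siegel theta function, with explicit constants

`θ(t) = ∫₀ᵗ θ'(u) du`, `θ'(u) = Re ψ(1/4 + iu/2)/2 − (log π)/2`
(`Literature.NumberTheory.LFunctions.riemannSiegelTheta`, `Literature.NumberTheory.LFunctions.riemannSiegelThetaDeriv`, file `RiemannSiegel.lean`). From the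
explicit vertical bound for the digamma function proved in
`Literature.Analysis.SpecialFunctions.DigammaGauss`,
`|Re ψ(w) − log ‖w‖| ≤ 1/(2‖w‖²) + π/(4|Im w|)`
(`Literature.Analysis.SpecialFunctions.Complex.abs_re_digamma_sub_log_norm_le`), we derive, with explicit constants:

* `abs_riemannSiegelThetaDeriv_sub_log_le`: `|θ'(u) − ½ log(u/2π)| ≤ 2/u` for `u ≥ 1`;
* `abs_riemannSiegelTheta_sub_stirlingMain_le`: for `t ≥ 1`,
  `|θ(t) − (t/2 · log(t/2π) − t/2) − C₁| ≤ 2 log t` with the constant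
  `C₁ = θ(1) − (½ log(1/2π) − ½)` (monotonicity of `θ − main ∓ 2 log`);
* `isBigO_riemannSiegelTheta_sub_stirlingMain`: `θ(t) = (t/2) log(t/2π) − t/2 + O(log t)` —
  the first-order form of the Stirling expansion `Literature.NumberTheory.LFunctions.isBigO_riemannSiegelTheta_sub_stirling`
  (which has `− π/8 + O(1/t)` and stays a named fact);
* `riemannSiegelThetaDeriv_pos`, `strictMonoOn_riemannSiegelTheta`: `θ' > 0` and `θ` is strictly
  increasing on `[4π, ∞)` (so Gram points `θ(gₙ) = nπ` are well defined there);
* `tendsto_riemannSiegelTheta_atTop`: `θ(t) → ∞`.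

(Titchmarsh §4.17 and Thm. 9.3–9.4; Edwards §6.5, where these follow from the full Stirling
series. The constants `2/u`, `2 log t`, `4π` are ours and far from optimal.)

## References

* E. C. Titchmarsh, *The Theory of the Riemann Zeta-Function*, 2nd ed. (OUP 1986), §4.17.
* H. M. Edwards, *Riemann's Zeta Function* (Academic Press 1974), §6.5.
-/

noncomputable section

open Complex Filter Set Asymptotics
open scoped Real Topology

namespace Literature.NumberTheory.LFunctions

/-- The main term `m(t) = (t/2) log(t/2π) − t/2` has derivative `½ log(t/2π)` for `t > 0`.
[folklore] -/
theorem hasDerivAt_stirlingMain {t : ℝ} (ht : 0 < t) :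
    HasDerivAt (fun t : ℝ ↦ t / 2 * Real.log (t / (2 * π)) - t / 2)
      (Real.log (t / (2 * π)) / 2) t := by
  have hπ : 0 < 2 * π := by positivity
  have ht0 : t ≠ 0 := ht.ne'
  have h1 : HasDerivAt (fun t : ℝ ↦ t / (2 * π)) (1 / (2 * π)) t := by
    simpa using (hasDerivAt_id t).div_const (2 * π)
  have h2 : HasDerivAt (fun t : ℝ ↦ Real.log (t / (2 * π))) (1 / t) t := by
    have hne : t / (2 * π) ≠ 0 := by positivity
    have h := h1.log hne
    have heq : 1 / (2 * π) / (t / (2 * π)) = 1 / t := by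
      field_simp
    rw [heq] at h
    exact h
  have h3 : HasDerivAt (fun t : ℝ ↦ t / 2) (1 / 2) t := by
    simpa using (hasDerivAt_id t).div_const 2
  have h4 := (h3.mul h2).sub h3
  have heq : 1 / 2 * Real.log (t / (2 * π)) + t / 2 * (1 / t) - 1 / 2 =
      Real.log (t / (2 * π)) / 2 := by
    field_simp
    ring
  rw [heq] at h4
  exact h4

/-- **Explicit bound for `θ'`**: `|θ'(u) − ½ log(u/2π)| ≤ 2/u` for `u ≥ 1`. Write
`w = 1/4 + iu/2`; then
`θ'(u) − ½ log(u/2π) = ½ (Re ψ(w) − log ‖w‖) + ½ (log ‖w‖ − log(u/2))`, the first bracket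
is at most `1/(2‖w‖²) + π/(2u) ≤ 2/u² + π/(2u)` in absolute value
(`Literature.Analysis.SpecialFunctions.Complex.abs_re_digamma_sub_log_norm_le`) and the second lies in `[0, 1/(8u²)]`
(`‖w‖² = 1/16 + u²/4`, `log x ≤ x − 1`). (Titchmarsh §4.17.) [folklore] -/
theorem abs_riemannSiegelThetaDeriv_sub_log_le {u : ℝ} (hu : 1 ≤ u) :
    |riemannSiegelThetaDeriv u - Real.log (u / (2 * π)) / 2| ≤ 2 / u := by
  have hu0 : 0 < u := by linarith
  have hπ : 0 < π := Real.pi_pos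
  set w : ℂ := 1 / 4 + (u : ℂ) / 2 * I with hw
  have hwre : w.re = 1 / 4 := by simp [hw]
  have hwim : w.im = u / 2 := by simp [hw]
  have hre : 0 < w.re := by rw [hwre]; norm_num
  have him : w.im ≠ 0 := by rw [hwim]; positivity
  have hnsq : ‖w‖ ^ 2 = 1 / 16 + u ^ 2 / 4 := by
    rw [Complex.sq_norm, Complex.normSq_apply, hwre, hwim]; ring
  have hn0 : 0 ≤ ‖w‖ := norm_nonneg w
  have hnpos : 0 < ‖w‖ := by
    rcases hn0.eq_or_lt with h | h
    · exfalso
      have : ‖w‖ ^ 2 = 0 := by rw [← h]; ring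
      rw [hnsq] at this
      nlinarith
    · exact h
  -- (1) the digamma bound
  have hdig := Literature.Analysis.SpecialFunctions.Complex.abs_re_digamma_sub_log_norm_le hre him
  rw [hwim, abs_of_pos (by positivity : 0 < u / 2)] at hdig
  have hA : 1 / (2 * ‖w‖ ^ 2) ≤ 2 / u ^ 2 := by
    rw [hnsq, div_le_div_iff₀ (by positivity) (by positivity)]
    nlinarith
  have hB : π / (4 * (u / 2)) = π / (2 * u) := by
    field_simp
    ring
  rw [hB] at hdig
  -- (2) `0 ≤ log ‖w‖ − log (u/2) ≤ 1/(8u²)`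
  have hsq_le : (u / 2) ^ 2 ≤ ‖w‖ ^ 2 := by rw [hnsq]; nlinarith
  have hle : u / 2 ≤ ‖w‖ := by
    exact (pow_le_pow_iff_left₀ (by positivity) hn0 two_ne_zero).1 hsq_le
  have hlog1 : Real.log (u / 2) ≤ Real.log ‖w‖ := Real.log_le_log (by positivity) hle
  have hlog2 : Real.log ‖w‖ - Real.log (u / 2) ≤ 1 / (8 * u ^ 2) := by
    have h2 : Real.log (‖w‖ ^ 2 / (u / 2) ^ 2) = 2 * (Real.log ‖w‖ - Real.log (u / 2)) := by
      have ha : (‖w‖ ^ 2 : ℝ) ≠ 0 := by positivity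
      have hb : ((u / 2) ^ 2 : ℝ) ≠ 0 := by positivity
      rw [Real.log_div ha hb, Real.log_pow, Real.log_pow]
      push_cast
      ring
    have h3 : Real.log (‖w‖ ^ 2 / (u / 2) ^ 2) ≤ ‖w‖ ^ 2 / (u / 2) ^ 2 - 1 :=
      Real.log_le_sub_one_of_pos (by positivity)
    have h4 : ‖w‖ ^ 2 / (u / 2) ^ 2 - 1 = 1 / (4 * u ^ 2) := by
      rw [hnsq]
      field_simp
      ring
    have h5 : 2 * (1 / (8 * u ^ 2)) = 1 / (4 * u ^ 2) := by
      field_simp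
      ring
    linarith
  -- (3) rewrite `θ'(u) − ½ log(u/2π)` and combine
  have hθ : riemannSiegelThetaDeriv u = (Complex.digamma w).re / 2 - Real.log π / 2 := rfl
  have hlogsplit : Real.log (u / (2 * π)) = Real.log (u / 2) - Real.log π := by
    have e : u / (2 * π) = u / 2 / π := by ring
    have hne : u / 2 ≠ 0 := by positivity
    rw [e, Real.log_div hne hπ.ne']
  have hkey : riemannSiegelThetaDeriv u - Real.log (u / (2 * π)) / 2 =
      ((Complex.digamma w).re - Real.log ‖w‖) / 2 +
        (Real.log ‖w‖ - Real.log (u / 2)) / 2 := by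
    rw [hθ, hlogsplit]; ring
  rw [hkey]
  have hπ4 : π < 3.15 := Real.pi_lt_d2
  -- linearise in the atoms `A = 1/u`, `B = 1/u²`
  have hu2 : u ≤ u ^ 2 := by nlinarith
  have hBA : 1 / u ^ 2 ≤ 1 / u := one_div_le_one_div_of_le hu0 hu2
  have hA0 : 0 ≤ 1 / u := by positivity
  have q1 : 2 / u ^ 2 = 2 * (1 / u ^ 2) := by ring
  have q3 : 1 / (8 * u ^ 2) = 1 / 8 * (1 / u ^ 2) := by ring
  have q4 : 2 / u = 2 * (1 / u) := by ring
  have e2 : π / (2 * u) ≤ 1.575 * (1 / u) :=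
    (div_le_div_of_nonneg_right hπ4.le (by positivity)).trans_eq (by ring)
  have hD := abs_le.1 hdig
  rw [abs_le]
  constructor
  · linarith [hD.1]
  · linarith [hD.2]

/-- **Explicit first-order Stirling bound for `θ`.** For `t ≥ 1`,
`|θ(t) − ((t/2) log(t/2π) − t/2) − C₁| ≤ 2 log t`, where
`C₁ = θ(1) − (½ log(1/2π) − ½)`.
Proof: by `abs_riemannSiegelThetaDeriv_sub_log_le`, `θ − main − 2 log` is non-increasing and
`θ − main + 2 log` is non-decreasing on `[1, ∞)`. (Titchmarsh §4.17.) [folklore] -/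
theorem abs_riemannSiegelTheta_sub_stirlingMain_le {t : ℝ} (ht : 1 ≤ t) :
    |riemannSiegelTheta t - (t / 2 * Real.log (t / (2 * π)) - t / 2)
      - (riemannSiegelTheta 1 - (1 / 2 * Real.log (1 / (2 * π)) - 1 / 2))| ≤ 2 * Real.log t := by
  set m : ℝ → ℝ := fun t ↦ t / 2 * Real.log (t / (2 * π)) - t / 2 with hm
  set F : ℝ → ℝ := fun t ↦ riemannSiegelTheta t - m t - 2 * Real.log t with hF
  set G : ℝ → ℝ := fun t ↦ riemannSiegelTheta t - m t + 2 * Real.log t with hG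
  have hlogd : ∀ {x : ℝ}, 0 < x → HasDerivAt (fun t ↦ 2 * Real.log t) (2 / x) x := by
    intro x hx
    have h := (Real.hasDerivAt_log hx.ne').const_mul 2
    have heq : (2 : ℝ) * x⁻¹ = 2 / x := by rw [div_eq_mul_inv]
    rw [heq] at h
    exact h
  have hFd : ∀ {x : ℝ}, 0 < x →
      HasDerivAt F (riemannSiegelThetaDeriv x - Real.log (x / (2 * π)) / 2 - 2 / x) x :=
    fun hx ↦
      ((hasDerivAt_riemannSiegelTheta_holds _).sub (hasDerivAt_stirlingMain hx)).sub (hlogd hx)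
  have hGd : ∀ {x : ℝ}, 0 < x →
      HasDerivAt G (riemannSiegelThetaDeriv x - Real.log (x / (2 * π)) / 2 + 2 / x) x :=
    fun hx ↦
      ((hasDerivAt_riemannSiegelTheta_holds _).sub (hasDerivAt_stirlingMain hx)).add (hlogd hx)
  have hFc : ContinuousOn F (Ici 1) := fun x hx ↦
    (hFd (by exact lt_of_lt_of_le one_pos hx)).continuousAt.continuousWithinAt
  have hGc : ContinuousOn G (Ici 1) := fun x hx ↦
    (hGd (by exact lt_of_lt_of_le one_pos hx)).continuousAt.continuousWithinAt
  have hFanti : AntitoneOn F (Ici 1) := by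
    refine antitoneOn_of_deriv_nonpos (convex_Ici 1) hFc ?_ ?_
    · intro x hx
      rw [interior_Ici] at hx
      exact (hFd (lt_trans one_pos hx)).differentiableAt.differentiableWithinAt
    · intro x hx
      rw [interior_Ici] at hx
      rw [(hFd (lt_trans one_pos hx)).deriv]
      have hb := (abs_le.1 (abs_riemannSiegelThetaDeriv_sub_log_le hx.le)).2
      linarith
  have hGmono : MonotoneOn G (Ici 1) := by
    refine monotoneOn_of_deriv_nonneg (convex_Ici 1) hGc ?_ ?_
    · intro x hx
      rw [interior_Ici] at hx
      exact (hGd (lt_trans one_pos hx)).differentiableAt.differentiableWithinAt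
    · intro x hx
      rw [interior_Ici] at hx
      rw [(hGd (lt_trans one_pos hx)).deriv]
      have hb := (abs_le.1 (abs_riemannSiegelThetaDeriv_sub_log_le hx.le)).1
      linarith
  have h1 : (1 : ℝ) ∈ Ici (1 : ℝ) := Set.self_mem_Ici
  have hA := hFanti h1 (Set.mem_Ici.2 ht) ht
  have hB := hGmono h1 (Set.mem_Ici.2 ht) ht
  simp only [hF, hG, hm, Real.log_one, mul_zero, sub_zero, add_zero] at hA hB
  rw [abs_le]
  constructor <;> linarith

/-- **`θ(t) = (t/2) log(t/2π) − t/2 + O(log t)`** as `t → ∞` (first-order Stirling for `θ`;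
Titchmarsh §4.17, Edwards §6.5 (6.5.3) give the finer `− π/8 + O(1/t)`, recorded as the named
fact `Literature.NumberTheory.LFunctions.isBigO_riemannSiegelTheta_sub_stirling`). [folklore] -/
theorem isBigO_riemannSiegelTheta_sub_stirlingMain :
    (fun t : ℝ ↦ riemannSiegelTheta t - (t / 2 * Real.log (t / (2 * π)) - t / 2))
      =O[atTop] Real.log := by
  set C : ℝ := riemannSiegelTheta 1 - (1 / 2 * Real.log (1 / (2 * π)) - 1 / 2) with hC
  refine IsBigO.of_bound (|C| + 2) ?_
  filter_upwards [eventually_ge_atTop (Real.exp 1)] with t ht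
  have he : (1 : ℝ) ≤ Real.exp 1 := by have := Real.add_one_le_exp (1 : ℝ); linarith
  have ht1 : 1 ≤ t := he.trans ht
  have hlog1 : 1 ≤ Real.log t := by
    rw [← Real.log_exp 1]
    exact Real.log_le_log (Real.exp_pos 1) ht
  have hb := abs_riemannSiegelTheta_sub_stirlingMain_le ht1
  rw [Real.norm_eq_abs, Real.norm_eq_abs, abs_of_pos (by linarith : 0 < Real.log t)]
  have h2 : |riemannSiegelTheta t - (t / 2 * Real.log (t / (2 * π)) - t / 2)| ≤
      2 * Real.log t + |C| := by
    have := abs_sub_abs_le_abs_sub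
      (riemannSiegelTheta t - (t / 2 * Real.log (t / (2 * π)) - t / 2)) C
    linarith
  nlinarith [abs_nonneg C]

/-- **`θ' > 0` on `[4π, ∞)`**: `θ'(u) ≥ ½ log(u/2π) − 2/u ≥ ½ log 2 − 1/(2π) > 0`.
(Edwards §6.5, p. 123: `ϑ'(t) > 0` for `t ≥ 10`; our threshold `4π` is not optimal.)
[folklore] -/
theorem riemannSiegelThetaDeriv_pos {u : ℝ} (hu : 4 * π ≤ u) :
    0 < riemannSiegelThetaDeriv u := by
  have hπ : 3 < π := Real.pi_gt_three
  have hu1 : 1 ≤ u := by linarith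
  have hu0 : 0 < u := by linarith
  have hb := (abs_le.1 (abs_riemannSiegelThetaDeriv_sub_log_le hu1)).1
  have hlog : Real.log 2 ≤ Real.log (u / (2 * π)) :=
    Real.log_le_log two_pos (by rw [le_div_iff₀ (by positivity)]; linarith)
  have h2 : (0.6931471803 : ℝ) < Real.log 2 := Real.log_two_gt_d9
  have h3 : 2 / u ≤ 2 / (4 * π) := div_le_div_of_nonneg_left (by norm_num) (by positivity) hu
  have h4 : 2 / (4 * π) < 0.34 := by
    rw [div_lt_iff₀ (by positivity)]
    nlinarith
  linarith

/-- **`θ` is strictly increasing on `[4π, ∞)`** (so the Gram points `θ(gₙ) = nπ` are well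
defined and unique there). (Titchmarsh §4.17; Edwards §6.5.) [folklore] -/
theorem strictMonoOn_riemannSiegelTheta : StrictMonoOn riemannSiegelTheta (Ici (4 * π)) := by
  refine strictMonoOn_of_deriv_pos (convex_Ici _)
    (fun x _ ↦ (hasDerivAt_riemannSiegelTheta_holds x).continuousAt.continuousWithinAt) ?_
  intro x hx
  rw [interior_Ici] at hx
  rw [(hasDerivAt_riemannSiegelTheta_holds x).deriv]
  exact riemannSiegelThetaDeriv_pos hx.le

/-- **`θ(t) → ∞`** as `t → ∞` (indeed `θ(t) ≥ t/4` for all large `t`). [folklore] -/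
theorem tendsto_riemannSiegelTheta_atTop : Tendsto riemannSiegelTheta atTop atTop := by
  set C : ℝ := riemannSiegelTheta 1 - (1 / 2 * Real.log (1 / (2 * π)) - 1 / 2) with hC
  have hπ : 0 < 2 * π := by positivity
  have hlog : ∀ᶠ t : ℝ in atTop, |C| + 2 * Real.log t ≤ t / 4 := by
    have hc : (0 : ℝ) < 1 / 16 := by norm_num
    filter_upwards [Real.isLittleO_log_id_atTop.def hc, eventually_ge_atTop (1 : ℝ),
      eventually_ge_atTop (8 * |C|)] with t h1 ht hCt
    rw [Real.norm_of_nonneg (Real.log_nonneg ht), id, Real.norm_of_nonneg (by linarith)] at h1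
    linarith
  have hmain : ∀ᶠ t : ℝ in atTop, 2 ≤ Real.log (t / (2 * π)) := by
    filter_upwards [eventually_ge_atTop (2 * π * Real.exp 2)] with t ht
    have h1 : Real.exp 2 ≤ t / (2 * π) := by
      rw [le_div_iff₀ hπ]
      linarith
    have h2 := Real.log_le_log (Real.exp_pos 2) h1
    rwa [Real.log_exp] at h2
  have hev : ∀ᶠ t : ℝ in atTop, t / 4 ≤ riemannSiegelTheta t := by
    filter_upwards [hlog, hmain, eventually_ge_atTop (1 : ℝ)] with t hl hm ht
    have hb := (abs_le.1 (abs_riemannSiegelTheta_sub_stirlingMain_le ht)).1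
    have ht2 : 0 ≤ t / 2 := by positivity
    have hm' : t / 2 ≤ t / 2 * Real.log (t / (2 * π)) - t / 2 := by nlinarith
    have hC' : -|C| ≤ C := neg_abs_le C
    linarith
  exact tendsto_atTop_mono' atTop hev (tendsto_id.atTop_div_const (by norm_num))

end Literature.NumberTheory.LFunctions

end
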